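import Summits.HubbardSuperconductivity.HubbardSuperconductivity.Theorems.KacWindowPenaltyGlue
import Summits.HubbardSuperconductivity.HubbardSuperconductivity.Theorems.NoGoNogoThesis

/-!
# Route `KacWindowPenalty` — normal forms of the crux `WindowGap` (stmt-HubbardSuperconductivity-1088)

The route docstring states the crux `WindowGap` (an EXTENSIVE excess
`λ(Cε + a)L² ≤ minEnergyOn (H_L + λW_ε) K_L − minEnergyOn H_L K_L` of the Kac-window-penalised
sector ground energy) together with its "λ-FREE EQUIVALENT (up to constants): every unit `φ ∈ K_L`
with `⟨φ, W_ε φ⟩ ≤ (Cε + a)L²` has `⟨φ, H_L φ⟩ ≥ E_L + cL²` (take `λ = c/(Cε + a)`)". This module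
proves that equivalence as two finite-dimensional lemmas about an arbitrary matrix `H`, a matrix
`W` that is nonnegative on the unit vectors of a subspace `K`, and `λ > 0`:

* `le_minEnergyOn_add_smul_sub_of_depletionCost` — if every unit `φ ∈ K` with `Re ⟨φ, W φ⟩ ≤ B`
  has `Re ⟨φ, H φ⟩ ≥ minEnergyOn H K + c`, then `min c (λB) ≤ minEnergyOn (H + λW) K −
  minEnergyOn H K` (a unit trial vector either keeps its window weight `> B`, paying `λB`, or
  depletes it, paying `c`);
* `depletionCost_of_le_minEnergyOn_add_smul_sub` — conversely, a gap `λ(B + d) ≤ minEnergyOn (H +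
  λW) K − minEnergyOn H K` forces `Re ⟨φ, H φ⟩ ≥ minEnergyOn H K + λd` on every unit `φ ∈ K` with
  `Re ⟨φ, W φ⟩ ≤ B` (the variational principle for `H + λW` at `φ`);

and, in the route's own vocabulary (`W_ε` the Kac-window pair penalty, whose expectation is the
nonnegative windowed sum of pair structure factors, `re_dotProduct_kacWindow_mulVec`),

* `windowGapAt_of_depletionCost` — the λ-free extensive DEPLETION COST at `(U, δ)` implies the
  body of `WindowGap` at `(U, δ)` with `λ := c/(Cε + a)`;
* `windowGap_of_depletionCost` — hence `(∃ U > 0, δ ∈ (0,1/2), DepletionCost) → WindowGap`.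

These are supports for the crux (`--supports stmt-HubbardSuperconductivity-1088`); they carry no
physics. Tasaki (2020) §2.1 (variational principle); Wang et al., arXiv:2310.05844, §II. No new
definitions.
-/

-- the mandated namespace `Summit.<Summit>.<Problem>.Theorems` repeats `HubbardSuperconductivity`
-- (single-problem summit, D-0017), which the `dupNamespace` linter flags on every declaration
set_option linter.dupNamespace false

namespace Summit.HubbardSuperconductivity.HubbardSuperconductivity.Theorems

open Matrix Literature.MathematicalPhysics.QuantumLattice
open Summit.HubbardSuperconductivity.HubbardSuperconductivity.Theses.KacWindowPenalty (WindowGap)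

section Abstract

variable {n : Type*} [Fintype n]

/-- **Depletion cost ⇒ penalty gap.** Let `W` be nonnegative on the unit vectors of `K`, `λ > 0`,
`B > 0`, and suppose every unit `φ ∈ K` with `Re ⟨φ, W φ⟩ ≤ B` has
`minEnergyOn H K + c ≤ Re ⟨φ, H φ⟩`. Then `min c (λB) ≤ minEnergyOn (H + λW) K − minEnergyOn H K`
(for `K` containing a unit vector, so that both `sInf`s are honest). Proof: for a unit trial vector
`φ ∈ K`, `Re ⟨φ, (H + λW) φ⟩ = Re ⟨φ, H φ⟩ + λ Re ⟨φ, W φ⟩` is `≥ (E + c) + 0` if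
`Re ⟨φ, W φ⟩ ≤ B` and `≥ E + λB` otherwise (`E = minEnergyOn H K ≤ Re ⟨φ, H φ⟩`).
Tasaki (2020) §2.1. [folklore] -/
theorem le_minEnergyOn_add_smul_sub_of_depletionCost (H W : Matrix n n ℂ)
    (K : Submodule ℂ (n → ℂ)) (hK : ∃ ψ ∈ K, star ψ ⬝ᵥ ψ = 1)
    (hW : ∀ φ ∈ K, star φ ⬝ᵥ φ = 1 → 0 ≤ (star φ ⬝ᵥ W *ᵥ φ).re) {lam B c : ℝ}
    (hlam : 0 < lam)
    (hcost : ∀ φ ∈ K, star φ ⬝ᵥ φ = 1 → (star φ ⬝ᵥ W *ᵥ φ).re ≤ B →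
      H.minEnergyOn K + c ≤ (star φ ⬝ᵥ H *ᵥ φ).re) :
    min c (lam * B) ≤ (H + (lam : ℂ) • W).minEnergyOn K - H.minEnergyOn K := by
  obtain ⟨ψ₀, hψ₀K, hψ₀⟩ := hK
  rw [le_sub_iff_add_le']
  refine le_csInf ⟨_, ψ₀, hψ₀K, hψ₀, rfl⟩ ?_
  rintro E ⟨φ, hφK, hφ, rfl⟩
  rw [add_mulVec, dotProduct_add, Complex.add_re, smul_mulVec, dotProduct_smul, smul_eq_mul,
    Complex.re_ofReal_mul]
  have hE := minEnergyOn_le_re_rayleigh H K hφK hφ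
  have hW' := hW φ hφK hφ
  by_cases hB : (star φ ⬝ᵥ W *ᵥ φ).re ≤ B
  · have h1 := hcost φ hφK hφ hB
    have h2 : min c (lam * B) ≤ c := min_le_left _ _
    nlinarith
  · have hB' : B < (star φ ⬝ᵥ W *ᵥ φ).re := not_le.mp hB
    have h2 : min c (lam * B) ≤ lam * B := min_le_right _ _
    nlinarith

/-- **Penalty gap ⇒ depletion cost.** If `λ > 0` and
`λ(B + d) ≤ minEnergyOn (H + λW) K − minEnergyOn H K`, then every unit `φ ∈ K` with
`Re ⟨φ, W φ⟩ ≤ B` has `minEnergyOn H K + λd ≤ Re ⟨φ, H φ⟩`: by the variational principle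
`minEnergyOn (H + λW) K ≤ Re ⟨φ, H φ⟩ + λ Re ⟨φ, W φ⟩ ≤ Re ⟨φ, H φ⟩ + λB`.
Tasaki (2020) §2.1. [folklore] -/
theorem depletionCost_of_le_minEnergyOn_add_smul_sub (H W : Matrix n n ℂ)
    (K : Submodule ℂ (n → ℂ)) {lam B d : ℝ} (hlam : 0 < lam)
    (hgap : lam * (B + d) ≤ (H + (lam : ℂ) • W).minEnergyOn K - H.minEnergyOn K)
    {φ : n → ℂ} (hφK : φ ∈ K) (hφ : star φ ⬝ᵥ φ = 1) (hB : (star φ ⬝ᵥ W *ᵥ φ).re ≤ B) :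
    H.minEnergyOn K + lam * d ≤ (star φ ⬝ᵥ H *ᵥ φ).re := by
  have h1 := minEnergyOn_le_re_rayleigh (H + (lam : ℂ) • W) K hφK hφ
  rw [add_mulVec, dotProduct_add, Complex.add_re, smul_mulVec, dotProduct_smul, smul_eq_mul,
    Complex.re_ofReal_mul] at h1
  nlinarith

end Abstract

/-! ### The route's window operator -/

/-- **The Kac-window pair penalty is nonnegative in every vector**:
`0 ≤ Re ⟨ψ, W_ε ψ⟩ = Σ_{|q_m| ≤ ε} ‖Δ_d(m) ψ‖² / L²` (`re_dotProduct_kacWindow_mulVec`; each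
summand is a pair structure factor, `≥ 0`). [folklore] -/
theorem re_dotProduct_kacWindow_mulVec_nonneg (L : ℕ) [NeZero L] (ε : ℝ)
    (ψ : Fock (Orb (FermionTorus 2 L))) :
    0 ≤ (star ψ ⬝ᵥ (∑ m : Fin 2 → ZMod L,
        if (2 * Real.pi / (L : ℝ)) ^ 2 * (∑ i : Fin 2, (((m i).valMinAbs : ℤ) : ℝ) ^ 2) ≤ ε ^ 2 then
          ((L : ℂ) ^ 2)⁻¹ •
            (Matrix.conjTranspose (pairFieldAt dWaveFormFactor L m) * pairFieldAt dWaveFormFactor L m)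
        else 0) *ᵥ ψ).re := by
  rw [re_dotProduct_kacWindow_mulVec]
  refine Finset.sum_nonneg fun m _ => ?_
  split_ifs
  · exact pairStructureFactor_nonneg dWaveFormFactor L ψ m
  · exact le_rfl

/-- **λ-free normal form of the crux, one direction, at fixed `(U, δ)`.** Suppose the EXTENSIVE
DEPLETION COST holds at `(U, δ)`: for every tail allowance `C ≥ 0` and `ε₀ > 0` there are
`ε ∈ (0, ε₀]`, `c, a > 0`, `L₀` such that at every even `L ≥ L₀` every unit `φ ∈ K_L = szSector N_L 0`
with `Re ⟨φ, W_ε φ⟩ ≤ (Cε + a)L²` has `minEnergyOn H_L K_L + cL² ≤ Re ⟨φ, H_L φ⟩`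
(`H_L = hubbardTorus 2 L 1 U`, `N_L = 2⌊(1−δ)L²/2⌋`). Then the body of `WindowGap` holds at `(U, δ)`
with `λ := c/(Cε + a)`: `λ(Cε + a)L² = cL² = min (cL²) (λ(Cε + a)L²)` is below the penalty gap by
`le_minEnergyOn_add_smul_sub_of_depletionCost` (`K_L` contains a unit vector:
`exists_unit_groundStateInSector_hubbardTorus`; `W_ε ≥ 0`: `re_dotProduct_kacWindow_mulVec_nonneg`).
Tasaki (2020) §2.1; Wang et al., arXiv:2310.05844, §II. [folklore] -/
theorem windowGapAt_of_depletionCost {U δ : ℝ} (hδ : δ ∈ Set.Ioo (0 : ℝ) (1 / 2))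
    (hcost : ∀ C : ℝ, 0 ≤ C → ∀ ε₀ : ℝ, 0 < ε₀ → ∃ ε ∈ Set.Ioc (0 : ℝ) ε₀, ∃ c a : ℝ, 0 < c ∧ 0 < a ∧
      ∃ L₀ : ℕ, ∀ (L : ℕ) [NeZero L], L₀ ≤ L → Even L →
        ∀ φ : Fock (Orb (FermionTorus 2 L)), φ ∈ szSector (2 * ⌊(1 - δ) * (L : ℝ) ^ 2 / 2⌋₊) 0 →
          star φ ⬝ᵥ φ = 1 →
          (star φ ⬝ᵥ (∑ m : Fin 2 → ZMod L,
              if (2 * Real.pi / (L : ℝ)) ^ 2 * (∑ i : Fin 2, (((m i).valMinAbs : ℤ) : ℝ) ^ 2) ≤ ε ^ 2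
              then ((L : ℂ) ^ 2)⁻¹ • (Matrix.conjTranspose (pairFieldAt dWaveFormFactor L m) *
                pairFieldAt dWaveFormFactor L m)
              else 0) *ᵥ φ).re ≤ (C * ε + a) * (L : ℝ) ^ 2 →
          (hubbardTorus 2 L 1 U).minEnergyOn (szSector (2 * ⌊(1 - δ) * (L : ℝ) ^ 2 / 2⌋₊) 0) +
              c * (L : ℝ) ^ 2 ≤
            (star φ ⬝ᵥ hubbardTorus 2 L 1 U *ᵥ φ).re) :
    ∀ C : ℝ, 0 ≤ C → ∀ ε₀ : ℝ, 0 < ε₀ → ∃ ε ∈ Set.Ioc (0 : ℝ) ε₀, ∃ lam a : ℝ, 0 < lam ∧ 0 < a ∧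
      ∃ L₀ : ℕ, ∀ (L : ℕ) [NeZero L], L₀ ≤ L → Even L →
        lam * (C * ε + a) * (L : ℝ) ^ 2 ≤
          (hubbardTorus 2 L 1 U + (lam : ℂ) • (∑ m : Fin 2 → ZMod L,
              if (2 * Real.pi / (L : ℝ)) ^ 2 * (∑ i : Fin 2, (((m i).valMinAbs : ℤ) : ℝ) ^ 2) ≤ ε ^ 2
              then ((L : ℂ) ^ 2)⁻¹ • (Matrix.conjTranspose (pairFieldAt dWaveFormFactor L m) *
                pairFieldAt dWaveFormFactor L m)
              else 0)).minEnergyOn (szSector (2 * ⌊(1 - δ) * (L : ℝ) ^ 2 / 2⌋₊) 0) -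
            (hubbardTorus 2 L 1 U).minEnergyOn (szSector (2 * ⌊(1 - δ) * (L : ℝ) ^ 2 / 2⌋₊) 0) := by
  intro C hC ε₀ hε₀
  obtain ⟨ε, hε, c, a, hc, ha, L₀, hL⟩ := hcost C hC ε₀ hε₀
  have hB : 0 < C * ε + a := by nlinarith [hε.1]
  refine ⟨ε, hε, c / (C * ε + a), a, div_pos hc hB, ha, L₀, ?_⟩
  intro L _ hL₀ hE
  have hLpos : (0 : ℝ) < (L : ℝ) := Nat.cast_pos.2 (Nat.pos_of_ne_zero (NeZero.ne L))
  have hL2 : (0 : ℝ) < (L : ℝ) ^ 2 := by positivity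
  -- a unit vector in the sector
  obtain ⟨ψ₀, hψ₀, hψ₀gs⟩ :=
    Summit.HubbardSuperconductivity.NoGo.exists_unit_groundStateInSector_hubbardTorus L 1 U
      (Summit.HubbardSuperconductivity.NoGo.floor_pairNumber_le δ (by linarith [hδ.1]) L)
  have key := le_minEnergyOn_add_smul_sub_of_depletionCost (hubbardTorus 2 L 1 U) _
    (szSector (2 * ⌊(1 - δ) * (L : ℝ) ^ 2 / 2⌋₊) 0) ⟨ψ₀, hψ₀gs.1, hψ₀⟩
    (fun φ _ _ => re_dotProduct_kacWindow_mulVec_nonneg L ε φ) (div_pos hc hB)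
    (B := (C * ε + a) * (L : ℝ) ^ 2) (c := c * (L : ℝ) ^ 2)
    (fun φ hφK hφ hφB => hL L hL₀ hE φ hφK hφ hφB)
  have hmin : min (c * (L : ℝ) ^ 2) (c / (C * ε + a) * ((C * ε + a) * (L : ℝ) ^ 2)) =
      c / (C * ε + a) * (C * ε + a) * (L : ℝ) ^ 2 := by
    rw [div_mul_cancel₀ c hB.ne', ← mul_assoc, div_mul_cancel₀ c hB.ne', min_self]
  rw [hmin] at key
  exact key

/-- **λ-free normal form of the crux, converse direction, at fixed `(U, δ)`.** The body of
`WindowGap` at `(U, δ)` implies an extensive depletion cost below HALF the guaranteed window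
weight: for every `C ≥ 0`, `ε₀ > 0` there are `ε ∈ (0, ε₀]`, `λ, a > 0`, `L₀` such that at every
even `L ≥ L₀` every unit `φ ∈ K_L` with `Re ⟨φ, W_ε φ⟩ ≤ (Cε + a/2)L²` has
`minEnergyOn H_L K_L + λ(a/2)L² ≤ Re ⟨φ, H_L φ⟩` (`depletionCost_of_le_minEnergyOn_add_smul_sub`
with `B = (Cε + a/2)L²`, `d = (a/2)L²`, since `λ(Cε + a)L² = λ(B + d)`). Tasaki (2020) §2.1.
[folklore] -/
theorem depletionCost_of_windowGapAt {U δ : ℝ}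
    (hgap : ∀ C : ℝ, 0 ≤ C → ∀ ε₀ : ℝ, 0 < ε₀ → ∃ ε ∈ Set.Ioc (0 : ℝ) ε₀, ∃ lam a : ℝ, 0 < lam ∧ 0 < a ∧
      ∃ L₀ : ℕ, ∀ (L : ℕ) [NeZero L], L₀ ≤ L → Even L →
        lam * (C * ε + a) * (L : ℝ) ^ 2 ≤
          (hubbardTorus 2 L 1 U + (lam : ℂ) • (∑ m : Fin 2 → ZMod L,
              if (2 * Real.pi / (L : ℝ)) ^ 2 * (∑ i : Fin 2, (((m i).valMinAbs : ℤ) : ℝ) ^ 2) ≤ ε ^ 2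
              then ((L : ℂ) ^ 2)⁻¹ • (Matrix.conjTranspose (pairFieldAt dWaveFormFactor L m) *
                pairFieldAt dWaveFormFactor L m)
              else 0)).minEnergyOn (szSector (2 * ⌊(1 - δ) * (L : ℝ) ^ 2 / 2⌋₊) 0) -
            (hubbardTorus 2 L 1 U).minEnergyOn (szSector (2 * ⌊(1 - δ) * (L : ℝ) ^ 2 / 2⌋₊) 0)) :
    ∀ C : ℝ, 0 ≤ C → ∀ ε₀ : ℝ, 0 < ε₀ → ∃ ε ∈ Set.Ioc (0 : ℝ) ε₀, ∃ lam a : ℝ, 0 < lam ∧ 0 < a ∧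
      ∃ L₀ : ℕ, ∀ (L : ℕ) [NeZero L], L₀ ≤ L → Even L →
        ∀ φ : Fock (Orb (FermionTorus 2 L)), φ ∈ szSector (2 * ⌊(1 - δ) * (L : ℝ) ^ 2 / 2⌋₊) 0 →
          star φ ⬝ᵥ φ = 1 →
          (star φ ⬝ᵥ (∑ m : Fin 2 → ZMod L,
              if (2 * Real.pi / (L : ℝ)) ^ 2 * (∑ i : Fin 2, (((m i).valMinAbs : ℤ) : ℝ) ^ 2) ≤ ε ^ 2
              then ((L : ℂ) ^ 2)⁻¹ • (Matrix.conjTranspose (pairFieldAt dWaveFormFactor L m) *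
                pairFieldAt dWaveFormFactor L m)
              else 0) *ᵥ φ).re ≤ (C * ε + a / 2) * (L : ℝ) ^ 2 →
          (hubbardTorus 2 L 1 U).minEnergyOn (szSector (2 * ⌊(1 - δ) * (L : ℝ) ^ 2 / 2⌋₊) 0) +
              lam * (a / 2) * (L : ℝ) ^ 2 ≤
            (star φ ⬝ᵥ hubbardTorus 2 L 1 U *ᵥ φ).re := by
  intro C hC ε₀ hε₀
  obtain ⟨ε, hε, lam, a, hlam, ha, L₀, hL⟩ := hgap C hC ε₀ hε₀
  refine ⟨ε, hε, lam, a, hlam, ha, L₀, ?_⟩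
  intro L _ hL₀ hE φ hφK hφ hφB
  have hg := hL L hL₀ hE
  have hg' : lam * ((C * ε + a / 2) * (L : ℝ) ^ 2 + a / 2 * (L : ℝ) ^ 2) ≤
      (hubbardTorus 2 L 1 U + (lam : ℂ) • (∑ m : Fin 2 → ZMod L,
          if (2 * Real.pi / (L : ℝ)) ^ 2 * (∑ i : Fin 2, (((m i).valMinAbs : ℤ) : ℝ) ^ 2) ≤ ε ^ 2
          then ((L : ℂ) ^ 2)⁻¹ • (Matrix.conjTranspose (pairFieldAt dWaveFormFactor L m) *
            pairFieldAt dWaveFormFactor L m)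
          else 0)).minEnergyOn (szSector (2 * ⌊(1 - δ) * (L : ℝ) ^ 2 / 2⌋₊) 0) -
        (hubbardTorus 2 L 1 U).minEnergyOn (szSector (2 * ⌊(1 - δ) * (L : ℝ) ^ 2 / 2⌋₊) 0) := by
    have : lam * ((C * ε + a / 2) * (L : ℝ) ^ 2 + a / 2 * (L : ℝ) ^ 2) =
        lam * (C * ε + a) * (L : ℝ) ^ 2 := by ring
    rw [this]
    exact hg
  have key := depletionCost_of_le_minEnergyOn_add_smul_sub _ _ _ hlam hg' hφK hφ hφB
  have : lam * (a / 2 * (L : ℝ) ^ 2) = lam * (a / 2) * (L : ℝ) ^ 2 := by ring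
  rw [this] at key
  exact key

/-- **λ-free sufficient condition for the crux `WindowGap`** (stmt-HubbardSuperconductivity-1088):
the extensive depletion cost at SOME `U > 0`, `δ ∈ (0, 1/2)` implies `WindowGap`
(`windowGapAt_of_depletionCost`; the converse direction, gap ⇒ cost with `d` in place of `c`, is
`depletionCost_of_le_minEnergyOn_add_smul_sub`). Tasaki (2020) §2.1. [folklore] -/
theorem windowGap_of_depletionCost
    (h : ∃ U : ℝ, 0 < U ∧ ∃ δ ∈ Set.Ioo (0 : ℝ) (1 / 2),
      ∀ C : ℝ, 0 ≤ C → ∀ ε₀ : ℝ, 0 < ε₀ → ∃ ε ∈ Set.Ioc (0 : ℝ) ε₀, ∃ c a : ℝ, 0 < c ∧ 0 < a ∧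
      ∃ L₀ : ℕ, ∀ (L : ℕ) [NeZero L], L₀ ≤ L → Even L →
        ∀ φ : Fock (Orb (FermionTorus 2 L)), φ ∈ szSector (2 * ⌊(1 - δ) * (L : ℝ) ^ 2 / 2⌋₊) 0 →
          star φ ⬝ᵥ φ = 1 →
          (star φ ⬝ᵥ (∑ m : Fin 2 → ZMod L,
              if (2 * Real.pi / (L : ℝ)) ^ 2 * (∑ i : Fin 2, (((m i).valMinAbs : ℤ) : ℝ) ^ 2) ≤ ε ^ 2
              then ((L : ℂ) ^ 2)⁻¹ • (Matrix.conjTranspose (pairFieldAt dWaveFormFactor L m) *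
                pairFieldAt dWaveFormFactor L m)
              else 0) *ᵥ φ).re ≤ (C * ε + a) * (L : ℝ) ^ 2 →
          (hubbardTorus 2 L 1 U).minEnergyOn (szSector (2 * ⌊(1 - δ) * (L : ℝ) ^ 2 / 2⌋₊) 0) +
              c * (L : ℝ) ^ 2 ≤
            (star φ ⬝ᵥ hubbardTorus 2 L 1 U *ᵥ φ).re) :
    WindowGap := by
  obtain ⟨U, hU, δ, hδ, hcost⟩ := h
  exact ⟨U, hU, δ, hδ, windowGapAt_of_depletionCost hδ hcost⟩

end Summit.HubbardSuperconductivity.HubbardSuperconductivity.Theorems
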